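import Summits.AtomisticToContinuum.Crystallization.Theorems.LayeredLawsSelectHcp.Negative.IntegerForms

/-!
# Negative knowledge for crux `LayeredLawsSelectHcp` (stmt-AtomisticToContinuum-9226), III:
# the fcc lattice in cubic coordinates has exact cuboctahedral shells and is Barlow-like

Part III (`--supports stmt-AtomisticToContinuum-9226`). `fccD3 a = (a/√2)·D₃` (integer vectors of even
coordinate sum, scaled; nearest-neighbour distance `a`) as an additive subgroup of `ℝ³`:
`le_dist_of_mem_fccD3` (`a`-separated), **`shell_fccD3`** (its non-zero points of norm `≤ 5a/4` are
EXACTLY `a·fccKissingPattern`), **`goodShell_fccD3`** (so every point has a `(1/100)`-good fcc shell in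
the sense of the crux's H4 — with the identity isometry and tolerance unused), and **`barlowLike_fccD3`**
(H4's global clause: `ψ` induces a bijection `cubicMap` from the ideal fcc stacking
`barlowStacking 1 √(2/3) constHagg`, where `dist² = qf`, onto `fccD3 a`, where `dist² = a²·qf`; for
`9/10 ≤ a ≤ 1` ideal contacts go exactly onto the pairs at distance in `(0, 28/25]`). All `[folklore]`.
-/

noncomputable section

namespace Summit.AtomisticToContinuum.Crystallization.Theorems.LayeredLawsSelectHcp.Negative.FccLattice

open MeasureTheory Set
open Literature.MathematicalPhysics.StatisticalMechanics Literature.Geometry.DiscreteGeometry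
open Summit.AtomisticToContinuum.Crystallization.Theses.PalmUnimodularRigidity (LayeredLawsSelectHcp)
open Summit.AtomisticToContinuum.Crystallization.Theorems.ChargedEnergyGapNegative
  (eStar eStar_le bddBelow_energyPerParticle_lennardJones)

/-- Euclidean `3`-space. [folklore] -/
local notation "E3" => EuclideanSpace ℝ (Fin 3)
open Summit.AtomisticToContinuum.Crystallization.Theorems.LayeredLawsSelectHcp.Negative.DiracLaws
open Summit.AtomisticToContinuum.Crystallization.Theorems.LayeredLawsSelectHcp.Negative.IntegerForms

/-! ## §4 The fcc lattice at nearest-neighbour distance `a`, in cubic coordinates -/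

/-- The cubic scale: nearest-neighbour distance `a` means cubic coordinates scaled by `a/√2`.
[folklore] -/
def cs (a : ℝ) : ℝ := a * (Real.sqrt 2)⁻¹

/-- `cs a > 0` for `a > 0`. [folklore] -/
theorem cs_pos {a : ℝ} (ha : 0 < a) : 0 < cs a := by unfold cs; positivity

/-- `cs a · √2 = a`. [folklore] -/
theorem cs_mul_sqrt_two (a : ℝ) : cs a * Real.sqrt 2 = a := by
  unfold cs
  rw [mul_assoc, inv_mul_cancel₀ (by positivity), mul_one]

/-- `(cs a)² = a²/2`. [folklore] -/
theorem cs_sq (a : ℝ) : cs a ^ 2 = a ^ 2 / 2 := by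
  unfold cs
  rw [mul_pow, inv_pow, Real.sq_sqrt (by norm_num : (0 : ℝ) ≤ 2)]
  ring

/-- **The fcc lattice `(a/√2)·D₃`** (nearest-neighbour distance `a`; integer vectors of even
coordinate sum), as an additive subgroup of `ℝ³`. [folklore] -/
def fccD3 (a : ℝ) : AddSubgroup E3 where
  carrier := {z | ∃ v : Fin 3 → ℤ, Even (v 0 + v 1 + v 2) ∧ z = cs a • intVec v}
  zero_mem' := ⟨0, by simp, by rw [intVec_zero, smul_zero]⟩
  add_mem' := by
    rintro _ _ ⟨v, hv, rfl⟩ ⟨w, hw, rfl⟩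
    refine ⟨v + w, ?_, by rw [intVec_add, smul_add]⟩
    have : (v + w) 0 + (v + w) 1 + (v + w) 2 = (v 0 + v 1 + v 2) + (w 0 + w 1 + w 2) := by
      simp only [Pi.add_apply]; ring
    rw [this]
    exact hv.add hw
  neg_mem' := by
    rintro _ ⟨v, hv, rfl⟩
    refine ⟨-v, ?_, by rw [intVec_neg, smul_neg]⟩
    have : (-v) 0 + (-v) 1 + (-v) 2 = -(v 0 + v 1 + v 2) := by simp only [Pi.neg_apply]; ring
    rw [this]
    exact hv.neg

/-- Membership in `fccD3 a`. [folklore] -/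
theorem mem_fccD3 {a : ℝ} {z : E3} :
    z ∈ (fccD3 a : Set E3) ↔ ∃ v : Fin 3 → ℤ, Even (v 0 + v 1 + v 2) ∧ z = cs a • intVec v :=
  Iff.rfl

/-- `fccD3 a` is countable. [folklore] -/
theorem countable_fccD3 (a : ℝ) : (fccD3 a : Set E3).Countable :=
  (Set.countable_range fun v : Fin 3 → ℤ => cs a • intVec v).mono (by
    rintro _ ⟨v, -, rfl⟩; exact ⟨v, rfl⟩)

/-- **`fccD3 a` is `a`-separated** (`a > 0`): distinct points differ by `cs a • intVec u` with
`u ≠ 0` of even sum, `|u|² ≥ 2`. [folklore] -/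
theorem le_dist_of_mem_fccD3 {a : ℝ} (ha : 0 < a) {x y : E3} (hx : x ∈ (fccD3 a : Set E3))
    (hy : y ∈ (fccD3 a : Set E3)) (hne : x ≠ y) : a ≤ dist x y := by
  obtain ⟨v, hv, rfl⟩ := hx
  obtain ⟨w, hw, rfl⟩ := hy
  have hvw : v - w ≠ 0 := by
    intro h; apply hne; rw [sub_eq_zero.1 h]
  have hev : Even ((v - w) 0 + (v - w) 1 + (v - w) 2) := by
    have : (v - w) 0 + (v - w) 1 + (v - w) 2 = (v 0 + v 1 + v 2) - (w 0 + w 1 + w 2) := by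
      simp only [Pi.sub_apply]; ring
    rw [this]
    exact hv.sub hw
  have h2 : (2 : ℝ) ≤ sqNormInt (v - w) := by exact_mod_cast two_le_sqNormInt hvw hev
  rw [dist_eq_norm, ← smul_sub, intVec_sub, norm_smul_intVec, abs_of_pos (cs_pos ha)]
  calc a = cs a * Real.sqrt 2 := (cs_mul_sqrt_two a).symm
    _ ≤ cs a * Real.sqrt (sqNormInt (v - w) : ℝ) :=
        mul_le_mul_of_nonneg_left (Real.sqrt_le_sqrt h2) (cs_pos ha).le

/-- **The `5/4`-shell of the origin in `fccD3 a` is the scaled cuboctahedron**: the non-zero points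
of norm `≤ 5a/4` are exactly the `cs a • intVec v`, `v ∈ fccInt` (all of norm `a`). [folklore] -/
theorem shell_fccD3 {a : ℝ} (ha : 0 < a) {z : E3} :
    (z ∈ (fccD3 a : Set E3) ∧ z ≠ 0 ∧ ‖z‖ ≤ 5 / 4 * a) ↔ ∃ v ∈ fccInt, z = cs a • intVec v := by
  constructor
  · rintro ⟨⟨v, hv, rfl⟩, hne, hle⟩
    refine ⟨v, ?_, rfl⟩
    have hv0 : v ≠ 0 := by
      rintro rfl; exact hne (by rw [intVec_zero, smul_zero])
    have h2 := two_le_sqNormInt hv0 hv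
    rw [norm_smul_intVec, abs_of_pos (cs_pos ha)] at hle
    have hs0 : (0 : ℝ) ≤ sqNormInt v := by exact_mod_cast (by omega : (0 : ℤ) ≤ sqNormInt v)
    have h4 : (cs a * Real.sqrt (sqNormInt v)) ^ 2 ≤ (5 / 4 * a) ^ 2 :=
      pow_le_pow_left₀ (mul_nonneg (cs_pos ha).le (Real.sqrt_nonneg _)) hle 2
    rw [mul_pow, Real.sq_sqrt hs0, cs_sq] at h4
    have h5 : (sqNormInt v : ℝ) < 4 := by nlinarith
    have h6 : sqNormInt v < 4 := by exact_mod_cast h5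
    have hs : sqNormInt v = 2 := by
      rcases even_sqNormInt hv with ⟨m, hm⟩
      omega
    exact mem_fccInt_of_sqNormInt hs
  · rintro ⟨v, hv, rfl⟩
    have hs : sqNormInt v = 2 := by exact_mod_cast sqNormInt_fccInt v hv
    have hnorm : ‖cs a • intVec v‖ = a := by
      rw [norm_smul_intVec, abs_of_pos (cs_pos ha), hs]
      push_cast
      exact cs_mul_sqrt_two a
    refine ⟨⟨v, even_of_mem_fccInt v hv, rfl⟩, ?_, ?_⟩
    · exact norm_pos_iff.1 (by rw [hnorm]; exact ha)
    · rw [hnorm]; linarith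

/-- The scaled cuboctahedron finset of the crux, as a set. [folklore] -/
theorem coe_image_smul_fccKissingPattern (a : ℝ) :
    (↑(Finset.image (fun v : E3 => a • v) fccKissingPattern) : Set E3) =
      {z | ∃ v ∈ fccInt, z = cs a • intVec v} := by
  ext z
  simp only [Finset.coe_image, fccKissingPattern, scaledPattern, Set.mem_image, Finset.mem_coe,
    Set.mem_setOf_eq]
  constructor
  · rintro ⟨_, ⟨v, hv, rfl⟩, rfl⟩
    exact ⟨v, hv, by rw [smul_smul]; simp [cs]⟩
  · rintro ⟨v, hv, rfl⟩
    exact ⟨_, ⟨v, hv, rfl⟩, by rw [smul_smul]; simp [cs]⟩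

/-- **Every point of `fccD3 a` (`9/10 ≤ a ≤ 1`) has a `(1/100)`-good fcc shell** in the sense of
the crux — indeed an EXACT scaled cuboctahedron, matched with the identity isometry. [folklore] -/
theorem goodShell_fccD3 {a : ℝ} (h9 : 9 / 10 ≤ a) (h1 : a ≤ 1) {x : E3}
    (hx : x ∈ (fccD3 a : Set E3)) : GoodShell (fccD3 a : Set E3) x := by
  have ha : 0 < a := by linarith
  refine ⟨a, h9, h1, Finset.image (fun v : E3 => a • v) fccKissingPattern, ?_,
    Or.inl (ShellCloseTo.refl (by positivity) _)⟩
  rw [coe_image_smul_fccKissingPattern]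
  ext z
  simp only [Set.mem_setOf_eq, Set.mem_image]
  rw [← shell_fccD3 ha]
  constructor
  · rintro ⟨hz, hne, hle⟩
    refine ⟨z + x, ⟨(fccD3 a).add_mem hz hx, ?_, ?_⟩, add_sub_cancel_right z x⟩
    · intro h
      apply hne
      simpa using h
    · rw [dist_eq_norm, add_sub_cancel_right]
      exact hle
  · rintro ⟨y, ⟨hy, hne, hle⟩, rfl⟩
    refine ⟨(fccD3 a).sub_mem hy hx, sub_ne_zero.2 hne, ?_⟩
    rw [← dist_eq_norm]
    exact hle

/-! ## §5 The bond-isomorphism from the ideal hexagonal-layer fcc stacking onto `fccD3 a` -/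

/-- The bond-isomorphism `Φ`: a point `barlowPos 1 √(2/3) constHagg k i j` of the ideal unit fcc
stacking goes to `cs a • intVec (ψ(k,i,j))`; `0` off the stacking. [folklore] -/
def cubicMap (a η : ℝ) (z : E3) : E3 :=
  haveI := Classical.propDecidable
  if hz : ∃ t : ℤ × ℤ × ℤ, z = barlowPos 1 η constHagg t.1 t.2.1 t.2.2 then
    cs a • intVec (psi hz.choose) else 0

/-- The value of `Φ` on the stacking. [folklore] -/
theorem cubicMap_barlowPos {η : ℝ} (hη : η ^ 2 = 2 / 3) (a : ℝ) (k i j : ℤ) :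
    cubicMap a η (barlowPos 1 η constHagg k i j) = cs a • intVec (psi (k, i, j)) := by
  have hz : ∃ t : ℤ × ℤ × ℤ, barlowPos 1 η constHagg k i j = barlowPos 1 η constHagg t.1 t.2.1 t.2.2 :=
    ⟨(k, i, j), rfl⟩
  unfold cubicMap
  rw [dif_pos hz]
  obtain ⟨h1, h2, h3⟩ := barlowPos_const_injective hη hz.choose_spec
  have hc : hz.choose = (k, i, j) := Prod.ext h1.symm (Prod.ext h2.symm h3.symm)
  rw [hc]

/-- **`Φ` is a bijection** from the ideal unit fcc stacking onto `fccD3 a` (`a > 0`). [folklore] -/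
theorem bijOn_cubicMap {η : ℝ} (hη : η ^ 2 = 2 / 3) {a : ℝ} (ha : 0 < a) :
    Set.BijOn (cubicMap a η) (barlowStacking 1 η constHagg) (fccD3 a : Set E3) := by
  refine ⟨?_, ?_, ?_⟩
  · rintro _ ⟨k, i, j, rfl⟩
    rw [cubicMap_barlowPos hη]
    refine ⟨psi (k, i, j), ?_, rfl⟩
    rw [psi_sum]
    exact even_two_mul _
  · rintro _ ⟨k, i, j, rfl⟩ _ ⟨k', i', j', rfl⟩ h
    rw [cubicMap_barlowPos hη, cubicMap_barlowPos hη] at h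
    have h1 : intVec (psi (k, i, j)) = intVec (psi (k', i', j')) :=
      smul_right_injective E3 (cs_pos ha).ne' h
    have h2 := psi_injective (intVec_injective h1)
    simp only [Prod.mk.injEq] at h2
    obtain ⟨rfl, rfl, rfl⟩ := h2
    rfl
  · rintro w ⟨v, ⟨m, hm⟩, rfl⟩
    refine ⟨barlowPos 1 η constHagg m (m - v 0 - v 2) (m - v 0 - v 1), barlowPos_mem _ _ _, ?_⟩
    rw [cubicMap_barlowPos hη]
    congr 2
    funext l
    fin_cases l <;> simp [psi] <;> omega

/-- Distances after `Φ`: `dist(Φp, Φq)² = a² · qf(Δi, Δj, Δk)`. [folklore] -/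
theorem dist_cubicMap_sq {η : ℝ} (hη : η ^ 2 = 2 / 3) (a : ℝ) (k i j k' i' j' : ℤ) :
    dist (cubicMap a η (barlowPos 1 η constHagg k i j))
        (cubicMap a η (barlowPos 1 η constHagg k' i' j')) ^ 2 =
      a ^ 2 * (qf (i - i') (j - j') (k - k') : ℝ) := by
  rw [cubicMap_barlowPos hη, cubicMap_barlowPos hη, dist_eq_norm, ← smul_sub, intVec_sub, psi_sub,
    norm_smul_intVec, sqNormInt_psi]
  have hq : (0 : ℝ) ≤ ((2 * qf (i - i') (j - j') (k - k') : ℤ) : ℝ) := by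
    exact_mod_cast mul_nonneg zero_le_two (qf_nonneg _ _ _)
  rw [mul_pow, sq_abs, Real.sq_sqrt hq, cs_sq]
  push_cast
  ring

/-- **`Φ` carries ideal contacts exactly onto the pairs at distance in `(0, 28/25]`** (for
`9/10 ≤ a ≤ 1`; both are the pairs with `qf = 1`, i.e. at distance `a` in `fccD3 a`). [folklore] -/
theorem bond_iff_cubicMap {η : ℝ} (hη : η ^ 2 = 2 / 3) {a : ℝ} (h9 : 9 / 10 ≤ a) (h1 : a ≤ 1)
    {p q : E3} (hp : p ∈ barlowStacking 1 η constHagg) (hq : q ∈ barlowStacking 1 η constHagg) :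
    dist p q = 1 ↔ (0 < dist (cubicMap a η p) (cubicMap a η q) ∧
      dist (cubicMap a η p) (cubicMap a η q) ≤ 28 / 25) := by
  obtain ⟨k, i, j, rfl⟩ := hp
  obtain ⟨k', i', j', rfl⟩ := hq
  have ha : 0 < a := by linarith
  have hd := dist_sq_hexFcc hη k i j k' i' j'
  have hD := dist_cubicMap_sq hη a k i j k' i' j'
  set Q : ℤ := qf (i - i') (j - j') (k - k') with hQdef
  set d : ℝ := dist (barlowPos 1 η constHagg k i j) (barlowPos 1 η constHagg k' i' j') with hddef
  set D : ℝ := dist (cubicMap a η (barlowPos 1 η constHagg k i j))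
    (cubicMap a η (barlowPos 1 η constHagg k' i' j')) with hDdef
  have hd0 : 0 ≤ d := dist_nonneg
  have hD0 : 0 ≤ D := dist_nonneg
  constructor
  · intro hd1
    have hQ : (Q : ℝ) = 1 := by rw [← hd, hd1]; norm_num
    have hD1 : D = a := by
      have : D ^ 2 = a ^ 2 := by rw [hD, hQ, mul_one]
      exact (pow_left_inj₀ hD0 ha.le two_ne_zero).1 this
    rw [hD1]
    exact ⟨ha, by linarith⟩
  · rintro ⟨hpos, hle⟩
    have hQ1 : 1 ≤ Q := by
      have h2 : 0 < D ^ 2 := by positivity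
      rw [hD] at h2
      have h3 : (0 : ℝ) < Q := (mul_pos_iff_of_pos_left (by positivity)).1 h2
      have h4 : (0 : ℤ) < Q := by exact_mod_cast h3
      omega
    have hQ2 : Q ≤ 1 := by
      have h2 : D ^ 2 ≤ (28 / 25) ^ 2 := pow_le_pow_left₀ hD0 hle 2
      rw [hD] at h2
      have ha2 : (81 / 100 : ℝ) ≤ a ^ 2 := by nlinarith
      by_contra hQ2
      push Not at hQ2
      have h5 : (2 : ℝ) ≤ Q := by exact_mod_cast hQ2
      nlinarith
    have hQ : Q = 1 := le_antisymm hQ2 hQ1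
    have h6 : d ^ 2 = 1 ^ 2 := by rw [hd, hQ]; norm_num
    exact (pow_left_inj₀ hd0 zero_le_one two_ne_zero).1 h6

/-- **`fccD3 a` is Barlow-like** in the sense of the crux (`9/10 ≤ a ≤ 1`): globally bond-isomorphic
to the ideal fcc stacking `barlowStacking 1 √(2/3) constHagg`. [folklore] -/
theorem barlowLike_fccD3 {a : ℝ} (h9 : 9 / 10 ≤ a) (h1 : a ≤ 1) : BarlowLike (fccD3 a : Set E3) := by
  have hη : (Real.sqrt (2 / 3)) ^ 2 = 2 / 3 := Real.sq_sqrt (by norm_num)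
  exact ⟨constHagg, isHaggSeq_const, cubicMap a (Real.sqrt (2 / 3)), bijOn_cubicMap hη (by linarith),
    fun p hp q hq => bond_iff_cubicMap hη h9 h1 hp hq⟩

end Summit.AtomisticToContinuum.Crystallization.Theorems.LayeredLawsSelectHcp.Negative.FccLattice

end
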